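import Literature.NumberTheory.LFunctions.ZetaZeroHarmonicLimitNumerics
import HarnessLib

/-!
# RH-FREE — `Σ_{0<γ≤T} 1/γ = log²(T/2π)/(4π) + H + O(log T/T)` as tree theorems: the rate with standard axioms (`(0.7222 log T + 20.85)/T` from the Hasanalizade–Shen–Wong bound), the `IsBigO` form, and the fully numerical two-sided bound `|Σ_{0<γ≤T} 1/γ − log²(T/2π)/(4π) + 0.0171594| ≤ 5·10⁻⁷ + 2.2(2 log T + 1)/T` (Brent–Platt–Trudgian 2021, Bull. Aust. Math. Soc. 104, Thm 1 and eq. (2.10)) («nothing here bears on the truth of RH»)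

Topic `Literature/NumberTheory/LFunctions` (RH literature-typing tranche 1, L4 "explicit zero
statistics", gen 7). Label: **RH-FREE**. THEOREMS only; NO definition, NO named fact. Nothing here bears
on the truth of RH.

Source: R. P. Brent, D. J. Platt, T. S. Trudgian, *A harmonic sum over nontrivial zeros of the Riemann
zeta-function*, Bull. Aust. Math. Soc. 104 (2021) 59–65 = arXiv:2009.05251, Theorem 1 (existence of
`H`), §1 ("if the definition (1.1) is used directly with the zeros up to height `T`, then the error is
`O((log T)/T)`") and §4 eq. (2.10) `[corpus:paper:arxiv-2009.05251 p0003, p0006]`. The constant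
`H = zetaZeroHarmonicLimit`, the limit theorem and eq. (2.10) for `|N − L| ≤ A log t` are the tree's
`ZetaZeroHarmonicLimit.lean`; the kernel enclosure `|H + 0.0171594| ≤ 5·10⁻⁷` is
`ZetaZeroHarmonicLimitNumerics.lean`.

## What is proved

* `abs_sum_inv_ordinate_sub_log_sq_sub_harmonicLimit_le_of_count'` — eq. (2.10) for a two-parameter
  count bound `|N(t) − L(t)| ≤ A log t + B` (`t ≥ 2π`): `|G(T) − log²(T/2π)/(4π) − H| ≤ (2A log T + A + 2B)/T`;
  `abs_sum_inv_ordinate_sub_log_sq_sub_harmonicLimit_le_hsw` — with the tree's PROVED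
  Hasanalizade–Shen–Wong constants (standard axioms): `≤ (0.7222 log T + 20.85)/T` for `T ≥ 2π`;
  `isBigO_sum_inv_ordinate_sub_log_sq_sub_harmonicLimit` — **`G(T) − log²(T/2π)/(4π) − H = O(log T/T)`**
  (standard axioms).
* `abs_sum_inv_ordinate_sub_log_sq_add_le` — **with no named fact (computational certificates):
  `|G(T) − log²(T/2π)/(4π) + 0.0171594| ≤ 5·10⁻⁷ + 2.2(2 log T + 1)/T`** for every `T ≥ 2π` (compare the
  tree's `|G(T) − log²(T/2π)/(4π)| ≤ 0.9321`, Saouter–Trudgian–Demichel 2015, Lemma 2.10); and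
  `BrentPlattTrudgian2022_cor1.abs_sum_inv_sub_log_sq_add_le` (`0.28` in place of `2.2`, from BPT 2022 Cor. 1).

## References

* R. P. Brent, D. J. Platt, T. S. Trudgian, Bull. Aust. Math. Soc. 104 (2021) 59–65, Thm 1, §1, eq. (2.10).
  [BrentPlattTrudgian2021BAMS]
* R. P. Brent, D. J. Platt, T. S. Trudgian, J. Number Theory 238 (2022) 740–762, Cor. 1. [BrentPlattTrudgian2022]
* E. Hasanalizade, Q. Shen, P.-J. Wong, J. Number Theory 235 (2022), Cor. 1.2. [HasanalizadeShenWong2022]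
-/

noncomputable section

open Filter Set MeasureTheory intervalIntegral Asymptotics
open scoped Real Topology

namespace Literature.NumberTheory.LFunctions

open SchoenfeldBound

/-- **Eq. (2.10) for a two-parameter count bound**: if `|N(t) − L(t)| ≤ A log t + B` for all `t ≥ 2π`
(`A, B ≥ 0`), then for every `T ≥ 2π`,
`|Σ_{0<γ≤T} m(ρ)/γ − log²(T/2π)/(4π) − H| ≤ (2A log T + A + 2B)/T`
(`H − (G − log²/4π) = −Q(T)/T + ∫_T^∞ Q/t²`, `|∫_T^∞ Q/t²| ≤ (A log T + B)/T + A/T`).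
[cite: BrentPlattTrudgian2021BAMS, §4 eq. (2.10)] -/
theorem abs_sum_inv_ordinate_sub_log_sq_sub_harmonicLimit_le_of_count' {A B T : ℝ} (hA0 : 0 ≤ A)
    (hB0 : 0 ≤ B)
    (hA : ∀ t : ℝ, 2 * π ≤ t → |(zetaZeroCount t : ℝ) - countMain t| ≤ A * Real.log t + B)
    (hT : 2 * π ≤ T) :
    |∑ ρ ∈ zerosBetween 0 T, (riemannZetaZeroOrder ρ : ℝ) / ρ.im
        - Real.log (T / (2 * π)) ^ 2 / (4 * π) - zetaZeroHarmonicLimit| ≤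
      (2 * A * Real.log T + A + 2 * B) / T := by
  have hπ : 3 < π := Real.pi_gt_three
  have h0 : (0 : ℝ) < 2 * π := by positivity
  have h3 : (3 : ℝ) ≤ 2 * π := by linarith
  have hT0 : 0 < T := by linarith
  have hT3 : (3 : ℝ) ≤ T := by linarith
  -- `H − (G − log²/4π) = −Q(T)/T + ∫_T^∞ Q/t²`
  have hsplit := intervalIntegral.integral_Ioi_sub_Ioi (integrableOn_count_sub_countMain_div_sq h3) hT
  have hL1 := BrentPlattTrudgian2021BAMS_lemma1 hT
  have hkey : ∑ ρ ∈ zerosBetween 0 T, (riemannZetaZeroOrder ρ : ℝ) / ρ.im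
      - Real.log (T / (2 * π)) ^ 2 / (4 * π) - zetaZeroHarmonicLimit =
      ((zetaZeroCount T : ℝ) - countMain T) / T
        - ∫ t in Ioi T, ((zetaZeroCount t : ℝ) - countMain t) / t ^ 2 := by
    rw [zetaZeroHarmonicLimit]
    linarith
  have hQT : |((zetaZeroCount T : ℝ) - countMain T) / T| ≤ (A * Real.log T + B) / T := by
    rw [abs_div, abs_of_pos hT0]
    exact div_le_div_of_nonneg_right (hA T hT) hT0.le
  have hE : |∫ t in Ioi T, ((zetaZeroCount t : ℝ) - countMain t) / t ^ 2| ≤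
      (A * Real.log T + B) / T + A / T := by
    have hQ : ∀ t : ℝ, T ≤ t → |(zetaZeroCount t : ℝ) - countMain t| ≤ A * Real.log t + B :=
      fun t ht ↦ hA t (hT.trans ht)
    have h := BPT2021.abs_integral_Ioi_count_sub_countMain_mul_deriv_le hT3 hA0 hB0 hQ
      (BPT2021.hasDerivAt_one_div hT0) (BPT2021.continuousOn_neg_one_div_sq hT0)
      (fun t ht ↦ by have := hT0.trans_le ht; positivity)
      (fun t ht ↦ by
        have := hT0.trans_le ht
        exact div_nonpos_of_nonpos_of_nonneg (by norm_num) (by positivity))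
      (BPT2021.integrableOn_one_div_div hT0)
    rw [BPT2021.integral_Ioi_mul_neg_one_div_sq, abs_neg, BPT2021.integral_Ioi_one_div_div hT0] at h
    refine h.trans (le_of_eq ?_)
    field_simp
  rw [hkey]
  calc |((zetaZeroCount T : ℝ) - countMain T) / T
          - ∫ t in Ioi T, ((zetaZeroCount t : ℝ) - countMain t) / t ^ 2|
      ≤ |((zetaZeroCount T : ℝ) - countMain T) / T|
          + |∫ t in Ioi T, ((zetaZeroCount t : ℝ) - countMain t) / t ^ 2| := abs_sub _ _
    _ ≤ (A * Real.log T + B) / T + ((A * Real.log T + B) / T + A / T) := add_le_add hQT hE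
    _ = (2 * A * Real.log T + A + 2 * B) / T := by
        field_simp
        ring

/-- **The `O(log T/T)` rate with standard axioms**: for every `T ≥ 2π`,
`|Σ_{0<γ≤T} m(ρ)/γ − log²(T/2π)/(4π) − H| ≤ (0.7222 log T + 20.85)/T`, from the tree's PROVED
Hasanalizade–Shen–Wong bound in the form `|N − L| ≤ 0.3611 log t + 10.2425` (`t ≥ 3`,
`BPT2021.abs_count_sub_countMain_le`). [cite: BrentPlattTrudgian2021BAMS, §4 eq. (2.10)]
[cite: HasanalizadeShenWong2022, Corollary 1.2] -/
theorem abs_sum_inv_ordinate_sub_log_sq_sub_harmonicLimit_le_hsw {T : ℝ} (hT : 2 * π ≤ T) :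
    |∑ ρ ∈ zerosBetween 0 T, (riemannZetaZeroOrder ρ : ℝ) / ρ.im
        - Real.log (T / (2 * π)) ^ 2 / (4 * π) - zetaZeroHarmonicLimit| ≤
      (0.7222 * Real.log T + 20.85) / T := by
  have hπ : 3 < π := Real.pi_gt_three
  have hT0 : 0 < T := by linarith
  have h := abs_sum_inv_ordinate_sub_log_sq_sub_harmonicLimit_le_of_count' (by norm_num : (0 : ℝ) ≤ 0.3611)
    (by norm_num : (0 : ℝ) ≤ 10.2425) (fun t ht ↦ BPT2021.abs_count_sub_countMain_le (by linarith)) hT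
  refine h.trans (div_le_div_of_nonneg_right ?_ hT0.le)
  have : 0 ≤ Real.log T := Real.log_nonneg (by linarith)
  norm_num
  linarith

/-- **`Σ_{0<γ≤T} 1/γ − log²(T/2π)/(4π) − H = O(log T/T)`** (the source's §1: "the error is
`O((log T)/T)`"), standard axioms. [cite: BrentPlattTrudgian2021BAMS, §1 and eq. (2.10)] -/
theorem isBigO_sum_inv_ordinate_sub_log_sq_sub_harmonicLimit :
    (fun T : ℝ ↦ ∑ ρ ∈ zerosBetween 0 T, (riemannZetaZeroOrder ρ : ℝ) / ρ.im
        - Real.log (T / (2 * π)) ^ 2 / (4 * π) - zetaZeroHarmonicLimit) =O[atTop]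
      fun T : ℝ ↦ Real.log T / T := by
  have hπ : 3 < π := Real.pi_gt_three
  refine IsBigO.of_bound 22 ?_
  filter_upwards [eventually_ge_atTop (2 * π), eventually_ge_atTop (Real.exp 1)] with T hT hTe
  have hT0 : 0 < T := by linarith
  have hlog : 1 ≤ Real.log T := by
    rw [← Real.log_exp 1]; exact Real.log_le_log (Real.exp_pos 1) hTe
  have h := abs_sum_inv_ordinate_sub_log_sq_sub_harmonicLimit_le_hsw hT
  rw [Real.norm_eq_abs, Real.norm_eq_abs, abs_of_nonneg (div_nonneg (by linarith) hT0.le)]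
  refine h.trans ?_
  rw [mul_div_assoc']
  exact div_le_div_of_nonneg_right (by linarith) hT0.le

/-- **The harmonic sum over the zeros, two-sided and fully numerical, with NO named fact** (computational
certificates: the tree's 2000 certified zeros and Turing-method numerics behind `|H + 0.0171594| ≤ 5·10⁻⁷`,
and `|N − L| ≤ 2.2 log t`): for every `T ≥ 2π`,
`|Σ_{0<γ≤T} m(ρ)/γ − log²(T/2π)/(4π) + 0.0171594| ≤ 5·10⁻⁷ + 2.2(2 log T + 1)/T`.
[cite: BrentPlattTrudgian2021BAMS, Theorem 1, Corollary 1 and eq. (2.10)] -/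
theorem abs_sum_inv_ordinate_sub_log_sq_add_le {T : ℝ} (hT : 2 * π ≤ T) :
    |∑ ρ ∈ zerosBetween 0 T, (riemannZetaZeroOrder ρ : ℝ) / ρ.im
        - Real.log (T / (2 * π)) ^ 2 / (4 * π) + 0.0171594| ≤
      5e-7 + 2.2 * (2 * Real.log T + 1) / T := by
  have h1 := HarmonicLimitNumerics.abs_zetaZeroHarmonicLimit_add_le
  have h2 := abs_sum_inv_ordinate_sub_log_sq_sub_harmonicLimit_le hT
  have e : ∑ ρ ∈ zerosBetween 0 T, (riemannZetaZeroOrder ρ : ℝ) / ρ.im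
        - Real.log (T / (2 * π)) ^ 2 / (4 * π) + 0.0171594 =
      (zetaZeroHarmonicLimit - (-0.0171594))
        + (∑ ρ ∈ zerosBetween 0 T, (riemannZetaZeroOrder ρ : ℝ) / ρ.im
          - Real.log (T / (2 * π)) ^ 2 / (4 * π) - zetaZeroHarmonicLimit) := by ring
  rw [e]
  exact (abs_add_le _ _).trans (add_le_add h1 h2)

/-- The same with `A = 0.28` from the named fact BPT 2022, Cor. 1: for every `T ≥ 2π`,
`|Σ_{0<γ≤T} m(ρ)/γ − log²(T/2π)/(4π) + 0.0171594| ≤ 5·10⁻⁷ + 0.28(2 log T + 1)/T`.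
[cite: BrentPlattTrudgian2021BAMS, eq. (2.10)] [cite: BrentPlattTrudgian2022, Cor. 1] -/
theorem BrentPlattTrudgian2022_cor1.abs_sum_inv_sub_log_sq_add_le (h : BrentPlattTrudgian2022_cor1)
    {T : ℝ} (hT : 2 * π ≤ T) :
    |∑ ρ ∈ zerosBetween 0 T, (riemannZetaZeroOrder ρ : ℝ) / ρ.im
        - Real.log (T / (2 * π)) ^ 2 / (4 * π) + 0.0171594| ≤
      5e-7 + 0.28 * (2 * Real.log T + 1) / T := by
  have h1 := HarmonicLimitNumerics.abs_zetaZeroHarmonicLimit_add_le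
  have h2 := BrentPlattTrudgian2022_cor1.abs_sum_inv_sub_log_sq_sub_harmonicLimit_le h hT
  have e : ∑ ρ ∈ zerosBetween 0 T, (riemannZetaZeroOrder ρ : ℝ) / ρ.im
        - Real.log (T / (2 * π)) ^ 2 / (4 * π) + 0.0171594 =
      (zetaZeroHarmonicLimit - (-0.0171594))
        + (∑ ρ ∈ zerosBetween 0 T, (riemannZetaZeroOrder ρ : ℝ) / ρ.im
          - Real.log (T / (2 * π)) ^ 2 / (4 * π) - zetaZeroHarmonicLimit) := by ring
  rw [e]
  exact (abs_add_le _ _).trans (add_le_add h1 h2)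

end Literature.NumberTheory.LFunctions
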